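import Mathlib
import HarnessLib
import Summits.Parity.Statement
import Summits.Parity.GeneralizedHardyLittlewood.Theorems.FixedLowerQualitativeCoreDefs
import Summits.Parity.GeneralizedHardyLittlewood.Theses.SiegelSpectrumSplit
import Summits.Parity.GeneralizedHardyLittlewood.Theses.GhostBoundaryCarving
import Summits.Parity.GeneralizedHardyLittlewood.Theses.ArtinGenericSplit
import Summits.Parity.GeneralizedHardyLittlewood.Theses.ShiftedPrimeFactor
import Summits.Parity.GeneralizedHardyLittlewood.Theorems.GhostBoundaryCarvingTwoOfThreeNecessity
import Summits.Parity.GeneralizedHardyLittlewood.Theorems.ShiftedPrimeFactorNecessity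
import Summits.Parity.GeneralizedHardyLittlewood.Theorems.ArtinGenericSplitNecessity
import Literature.NumberTheory.Sieve.ParityWave0DicksonProofs
import Literature.NumberTheory.Sieve.ParityWave0TwinPrimeProofs
import Literature.NumberTheory.Sieve.HardyLittlewood
import Literature.NumberTheory.Sieve.PolymathBoundedGaps
import Literature.NumberTheory.Sieve.ParityWave0
import Literature.NumberTheory.Sieve.SingularSeries
import Literature.Barriers.Parity.HensleyRichards

/-!
# `FixedLower` — the qualitative core and the normal form of qualitative notches (helper for stmt-Parity-26863)

Structure theorem behind the decomp-parity STANDING TRAP T21 «qualitative-notch normal form at FL»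
(critic CLEARED HOME/STATUS.md l.417, CRITIC-LEDGER row 80: «if lens-2 wants the structure theorem in the
TREE: hand lane — core_iff / lift_iff / gap_iff / the three *_iff_floor instances / dickson_of_tupleChebyshev
as --kind proof --supports stmt-Parity-26863 --as helper»), ported verbatim from the lens-2 g8 kernel
`HOME/decomp-parity-lens-2/g8/QualitativeCoreFloor.lean` (@6dfa93032bcaf2cd, rc 0 · 0 sorry · standard
axioms) onto the BORN decls.  `FL` = `SiegelSpectrumSplit.FixedLower` (stmt-Parity-26863); `Dickson` = the
tree's `Literature.NumberTheory.Sieve.DicksonConjecture` (parity.S07); `QuantLift := Dickson → FL`.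

* §1 EXACT CUT (hypothesis-free): `core_iff : FL ↔ Dickson ∧ QuantLift`, via the LANDED necessity
  `ArtinGenericSplitNecessity.dicksonConjecture_of_fixedLower`; separating world ¬Dickson
  (`quantLift_of_not_dickson`, `not_fixedLower_of_not_dickson`); necessity from the conjunct / root.
* §2 FLOOR: for every `X` with `Dickson → X`, the notch residual `X → FL` implies `QuantLift` (`floor`);
  instances on the born residuals `GhostBoundaryCarving.PairLift` (29351), `ArtinGenericSplit.ArtinLift`
  (30687), `ShiftedPrimeFactor.FactorLift` (30954) and on `¬SecondHardyLittlewoodConjecture → FL`, through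
  the tree theorems `DicksonConjecture.weakDicksonHardyLittlewood` (`Dickson ⟹ DHL[k,k]`),
  `twinPrimeConjecture_of_dicksonConjecture`, `ArtinGenericSplitNecessity.artinTwo_of_dickson` and
  `DicksonConjecture.not_secondHardyLittlewoodConjecture`, used BY NAME:
  `Dickson ⟹ TwinPrimeConjecture / TwoOfThree / ArtinTwo / ShiftedLPF / ¬(second HL)`.
* §3 EXACT RELOCATION: `lift_iff : (X → FL) ↔ QuantLift ∧ (X → Dickson)` (given `Dickson → X`) and
  `gap_iff : (QuantLift → (X → FL)) ↔ (X → Dickson)` (NO hypothesis on `X`); `notch_normal_form`;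
  `pairLift_iff_floor`, `artinLift_iff_floor`, `factorLift_iff_floor`, `convexityLift_iff_floor`,
  `pairLift_iff_artinLift`.
* §4 SECOND LAYER: `FL ⟹ TupleChebyshev ⟹ Dickson` (`tupleChebyshev_of_fixedLower`,
  `dickson_of_tupleChebyshev` — the Chebyshev ψ − θ argument `exists_gt_forall_prime_of_lower` of
  `ArtinGenericSplitNecessity`, run at `ε = c𝔖/4`), hence `quantLift_iff_layers : QuantLift ↔
  OrderLift ∧ AsymptoticLift` and `fixedLower_iff_three`.

Helper file `--supports stmt-Parity-26863` (it closes no item).  0 sorry · standard axioms only.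
-/

open Literature.NumberTheory.Sieve

namespace Summit.Parity.GeneralizedHardyLittlewood.QualitativeCore

open Summit.Parity.GeneralizedHardyLittlewood.Theses.SiegelSpectrumSplit (FixedLower)
open Summit.Parity.GeneralizedHardyLittlewood.Theses.GhostBoundaryCarving (TwoOfThree PairLift)
open Summit.Parity.GeneralizedHardyLittlewood.Theses.ArtinGenericSplit (ArtinTwo ArtinLift)
open Summit.Parity.GeneralizedHardyLittlewood.Theses.ShiftedPrimeFactor (ShiftedLPF FactorLift)
open Summit.Parity.GeneralizedHardyLittlewood.Theses

/-! ## §1 Exactness of the cut `FL ⟺ Dickson ∧ QuantLift` (hypothesis-free) -/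

/-- Necessity of the residual: `FL → QuantLift` (a fortiori). -/
theorem quantLift_of_fixedLower (h : FixedLower) : QuantLift := fun _ => h

/-- The deciding step at the leaf: pieces ⟹ `FL`. -/
theorem closes_leaf (hD : DicksonConjecture) (hL : QuantLift) : FixedLower := hL hD

/-- EXACTNESS (hypothesis-free): `FL ⟺ DicksonConjecture ∧ QuantLift`. -/
theorem core_iff : FixedLower ↔ DicksonConjecture ∧ QuantLift :=
  ⟨fun h => ⟨ArtinGenericSplitNecessity.dicksonConjecture_of_fixedLower h, quantLift_of_fixedLower h⟩, fun h => h.2 h.1⟩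

/-- CONTRACTION RULE: the day Dickson lands, the residual IS the leaf. -/
theorem contracts (hD : DicksonConjecture) : QuantLift ↔ FixedLower :=
  ⟨fun hL => hL hD, fun h _ => h⟩

/-- STRICTNESS of the residual (separating world ¬Dickson, part 1): there `QuantLift` holds … -/
theorem quantLift_of_not_dickson (h : ¬ DicksonConjecture) : QuantLift := fun hD => (h hD).elim

/-- … (part 2) and `FL` fails; so `QuantLift ⇏ FL` unless Dickson is decided. -/
theorem not_fixedLower_of_not_dickson (h : ¬ DicksonConjecture) : ¬ FixedLower :=
  fun hFL => h (ArtinGenericSplitNecessity.dicksonConjecture_of_fixedLower hFL)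

/-! ### Necessity from the conjunct and the root -/

/-- Necessity from the conjunct: `GHL → QuantLift`. [folklore] -/
theorem quantLift_of_ghl (h : _root_.GeneralizedHardyLittlewood) : QuantLift :=
  quantLift_of_fixedLower (ShiftedPrimeFactor.fixedLower_of_ghl h)

/-- Necessity from the conjunct: `GHL → Dickson ∧ QuantLift`. [folklore] -/
theorem pieces_of_ghl (h : _root_.GeneralizedHardyLittlewood) : DicksonConjecture ∧ QuantLift :=
  core_iff.mp (ShiftedPrimeFactor.fixedLower_of_ghl h)

/-- Necessity from the root: `Parity → Dickson ∧ QuantLift`. [folklore] -/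
theorem pieces_of_parity (h : _root_.Parity) : DicksonConjecture ∧ QuantLift := pieces_of_ghl h.2

/-! ## §2 The floor: every qualitative notch residual implies `QuantLift` -/

/-- FLOOR SCHEMA: if `X` is a consequence of Dickson, the notch residual `X → FL` implies `QuantLift`. -/
theorem floor {X : Prop} (hX : DicksonConjecture → X) (hLift : X → FixedLower) : QuantLift :=
  fun hD => hLift (hX hD)

/-- The floor is ATTAINED: `QuantLift` is itself the residual of the notch `X = DicksonConjecture`. -/
theorem floor_attained : QuantLift = (DicksonConjecture → FixedLower) := rfl

/-- Dickson ⟹ DHL[3,2] (the G1.2.L notch `TwoOfThree`, stmt-Parity-29350), by monotonicity in `j`. -/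
theorem twoOfThree_of_dickson (hD : DicksonConjecture) : TwoOfThree :=
  (hD.weakDicksonHardyLittlewood 3).mono (by norm_num)

/-- Dickson ⟹ ShiftedLPF(17/25) (the G1.2.H notch, stmt-Parity-30953): through twin primes (landed
`ShiftedPrimeFactor.shiftedLPF_of_twinPrimeConjecture`, BY NAME). -/
theorem shiftedLPF_of_dickson (hD : DicksonConjecture) : ShiftedLPF :=
  ShiftedPrimeFactor.shiftedLPF_of_twinPrimeConjecture (twinPrimeConjecture_of_dicksonConjecture hD)

/-- FLOOR for G1.2.L: `PairLift` (stmt-Parity-29351) ⟹ `QuantLift`. -/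
theorem quantLift_of_pairLift (h : PairLift) : QuantLift :=
  floor twoOfThree_of_dickson (GhostBoundaryCarving.pairLift_iff.mp h)

/-- FLOOR for G1.2.A: `ArtinLift` (stmt-Parity-30687) ⟹ `QuantLift`. -/
theorem quantLift_of_artinLift (h : ArtinLift) : QuantLift :=
  floor ArtinGenericSplitNecessity.artinTwo_of_dickson (ArtinGenericSplitNecessity.artinLift_iff.mp h)

/-- FLOOR for G1.2.H: `FactorLift` (stmt-Parity-30954) ⟹ `QuantLift`. -/
theorem quantLift_of_factorLift (h : FactorLift) : QuantLift :=
  floor shiftedLPF_of_dickson (ShiftedPrimeFactor.factorLift_iff.mp h)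

/-- FLOOR for G1.2.C (lens-5 «ConvexityCrossing», unfiled): `(¬ second HL → FL)` ⟹ `QuantLift`. -/
theorem quantLift_of_convexityLift
    (h : ¬ Literature.Barriers.Parity.SecondHardyLittlewoodConjecture → FixedLower) : QuantLift :=
  floor DicksonConjecture.not_secondHardyLittlewoodConjecture h

/-- The floor schema CANNOT be reversed by logic alone, even granting necessity `F → D`:
witness `D := False`, `X := True`, `F := False`. -/
theorem floor_strict_abstract :
    ¬ ∀ (D X F : Prop), (D → X) → (F → D) → ((D → F) → (X → F)) :=
  fun h => h False True False (fun _ => trivial) id id trivial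

/-! ## §3 Exact relocation: the notch residual factors as (floor) ∧ (qualitative lift) -/

/-- NORMAL FORM OF A QUALITATIVE NOTCH RESIDUAL (hypothesis-free in `X`):
`(X → FL) ⟺ QuantLift ∧ (X → DicksonConjecture)` whenever `Dickson ⟹ X`. -/
theorem lift_iff {X : Prop} (hX : DicksonConjecture → X) :
    (X → FixedLower) ↔ QuantLift ∧ (X → DicksonConjecture) :=
  ⟨fun h => ⟨floor hX h, fun x => ArtinGenericSplitNecessity.dicksonConjecture_of_fixedLower (h x)⟩, fun h x => h.1 (h.2 x)⟩

/-- THE GAP IS EXACTLY THE QUALITATIVE LIFT (no hypothesis on `X` at all):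
`(QuantLift → (X → FL)) ⟺ (X → DicksonConjecture)`. -/
theorem gap_iff {X : Prop} : (QuantLift → (X → FixedLower)) ↔ (X → DicksonConjecture) := by
  constructor
  · intro h x
    by_contra hD
    exact hD (ArtinGenericSplitNecessity.dicksonConjecture_of_fixedLower (h (quantLift_of_not_dickson hD) x))
  · intro h hq x
    exact hq (h x)

/-- Given the floor, a notch residual IS its qualitative factor. -/
theorem lift_iff_qualitative_of_quantLift (hq : QuantLift) {X : Prop} :
    (X → FixedLower) ↔ (X → DicksonConjecture) :=
  ⟨fun h x => ArtinGenericSplitNecessity.dicksonConjecture_of_fixedLower (h x), fun h x => hq (h x)⟩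

/-- The qualitative factor is itself NECESSARY (trivially, through Dickson). -/
theorem qualitativeLift_of_fixedLower (h : FixedLower) {X : Prop} : X → DicksonConjecture :=
  fun _ => ArtinGenericSplitNecessity.dicksonConjecture_of_fixedLower h

/-- THREE-PIECE NORMAL FORM of every qualitative notch at `FL`:
`FL ⟺ X ∧ (X → Dickson) ∧ QuantLift` whenever `Dickson ⟹ X`. -/
theorem notch_normal_form {X : Prop} (hX : DicksonConjecture → X) :
    FixedLower ↔ X ∧ (X → DicksonConjecture) ∧ QuantLift :=
  ⟨fun h => ⟨hX (ArtinGenericSplitNecessity.dicksonConjecture_of_fixedLower h), fun _ => ArtinGenericSplitNecessity.dicksonConjecture_of_fixedLower h, quantLift_of_fixedLower h⟩,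
    fun h => h.2.2 (h.2.1 h.1)⟩

/-- G1.2.L in normal form: `PairLift ⟺ QuantLift ∧ (DHL[3,2] → Dickson)`. -/
theorem pairLift_iff_floor : PairLift ↔ QuantLift ∧ (TwoOfThree → DicksonConjecture) :=
  GhostBoundaryCarving.pairLift_iff.trans (lift_iff twoOfThree_of_dickson)

/-- G1.2.A in normal form: `ArtinLift ⟺ QuantLift ∧ (ArtinTwo → Dickson)`. -/
theorem artinLift_iff_floor : ArtinLift ↔ QuantLift ∧ (ArtinTwo → DicksonConjecture) :=
  ArtinGenericSplitNecessity.artinLift_iff.trans (lift_iff ArtinGenericSplitNecessity.artinTwo_of_dickson)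

/-- G1.2.H in normal form: `FactorLift ⟺ QuantLift ∧ (ShiftedLPF → Dickson)`. -/
theorem factorLift_iff_floor : FactorLift ↔ QuantLift ∧ (ShiftedLPF → DicksonConjecture) :=
  ShiftedPrimeFactor.factorLift_iff.trans (lift_iff shiftedLPF_of_dickson)

/-- G1.2.C in normal form: `ConvexityLift ⟺ QuantLift ∧ (¬(A) → Dickson)`. -/
theorem convexityLift_iff_floor :
    (¬ Literature.Barriers.Parity.SecondHardyLittlewoodConjecture → FixedLower) ↔
      QuantLift ∧ (¬ Literature.Barriers.Parity.SecondHardyLittlewoodConjecture → DicksonConjecture) :=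
  lift_iff DicksonConjecture.not_secondHardyLittlewoodConjecture

/-- The four filed residuals AGREE modulo their qualitative factors: given the qualitative lifts, each
is `QuantLift`. (Stated for the pair L/A; the others are identical.) -/
theorem pairLift_iff_artinLift (hL : TwoOfThree → DicksonConjecture) (hA : ArtinTwo → DicksonConjecture) :
    PairLift ↔ ArtinLift := by
  rw [pairLift_iff_floor, artinLift_iff_floor]
  exact ⟨fun h => ⟨h.1, hA⟩, fun h => ⟨h.1, hL⟩⟩

/-! ## §4 The second layer: `QuantLift ⟺ OrderLift ∧ AsymptoticLift` -/

/-- `FL ⟹ TupleChebyshev` (constant `c = 1`). -/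
theorem tupleChebyshev_of_fixedLower (h : FixedLower) : TupleChebyshev := by
  intro d t hd ht Ψ hΨ
  refine ⟨1, one_pos, fun ε hε => ?_⟩
  obtain ⟨N₀, hN₀⟩ := h d t hd ht Ψ hΨ ε hε
  exact ⟨N₀, fun N hN K hK hKN => by simpa only [one_mul] using hN₀ N hN K hK hKN⟩

section Chebyshev

open scoped BigOperators ArithmeticFunction.vonMangoldt
open Finset Filter MeasureTheory
open Summit.Parity.GeneralizedHardyLittlewood.ArtinGenericSplitNecessity

variable {t : ℕ}

/-- `TupleChebyshev` gives Dickson's conjecture for injective families, beyond every bound: the leaf's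
argument (`ArtinGenericSplitNecessity.dickson_injective_of_fixedLower`) run with `ε = c𝔖/4`, then the
landed `exists_gt_forall_prime_of_lower` (prime powers are `o(N)` by Chebyshev's `ψ − θ`). -/
theorem dickson_injective_of_tupleChebyshev (hTC : TupleChebyshev) (ht : 1 ≤ t) (a b : Fin t → ℕ)
    (ha : ∀ i, 1 ≤ a i) (hinj : Function.Injective fun i => (a i, b i))
    (hadm : ∀ p : ℕ, p.Prime → ∃ n : ℕ, ¬p ∣ ∏ i, (a i * n + b i)) (M₀ : ℕ) :
    ∃ m : ℕ, M₀ < m ∧ ∀ i, (a i * m + b i).Prime := by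
  have hnd : IsNondegenerateSystem (dsys a b) := isNondegenerateSystem_dsys a b ha hinj hadm
  have hSpos : 0 < singularProduct (dsys a b) := singularProduct_dsys_pos a b ha hinj hadm
  set S : ℝ := singularProduct (dsys a b) with hSdef
  obtain ⟨c, hc, hcε⟩ := hTC 1 t le_rfl ht (dsys a b) hnd
  obtain ⟨N₀, hN₀⟩ := hcε (c * S / 4) (by positivity)
  have hlb : ∃ N₁ : ℕ, ∀ N : ℕ, N₁ ≤ N →
      c * S / 2 * N ≤ ∑ m ∈ range (N + 1), ∏ i, (Λ (a i * m + b i) : ℝ) := by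
    refine ⟨N₀, fun N hN => ?_⟩
    have h := hN₀ N hN (body N) (convex_body N) (body_subset_realBox N)
    rw [vonMangoldtSum_dsys, pow_one] at h
    have hA : (N : ℝ) ≤ archFactor (dsys a b) (body N) := le_archFactor_dsys a b ha N
    have hAS : c * ((N : ℝ) * S) ≤ c * (archFactor (dsys a b) (body N) * S) :=
      mul_le_mul_of_nonneg_left (mul_le_mul_of_nonneg_right hA hSpos.le) hc.le
    have hN0 : (0 : ℝ) ≤ N := Nat.cast_nonneg N
    have hcSN : 0 ≤ c * S * N := by positivity
    nlinarith
  exact exists_gt_forall_prime_of_lower ht a b ha (by positivity : 0 < c * S / 2) hlb M₀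

/-- `TupleChebyshev ⟹ DicksonConjecture`: deduplicate the family (as in the landed
`dicksonConjecture_of_fixedLower`) and apply `dickson_injective_of_tupleChebyshev`. -/
theorem dickson_of_tupleChebyshev (hTC : TupleChebyshev) : DicksonConjecture := by
  intro k a b ha hadm
  refine Set.infinite_of_forall_exists_gt fun M₀ => ?_
  rcases Nat.eq_zero_or_pos k with hk | hk
  · subst hk
    exact ⟨M₀ + 1, fun i => Fin.elim0 i, Nat.lt_succ_self _⟩
  let F : Finset (ℕ × ℕ) := Finset.univ.image fun i => (a i, b i)
  have hFne : F.Nonempty := (Finset.image_nonempty).mpr ⟨⟨0, hk⟩, Finset.mem_univ _⟩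
  have ht1 : 1 ≤ F.card := Finset.card_pos.mpr hFne
  let e : Fin F.card ≃ {x // x ∈ F} := F.equivFin.symm
  let a' : Fin F.card → ℕ := fun j => (e j).1.1
  let b' : Fin F.card → ℕ := fun j => (e j).1.2
  have hmem : ∀ j, ∃ i, a i = a' j ∧ b i = b' j := fun j => by
    obtain ⟨i, -, hi⟩ := Finset.mem_image.mp (e j).2
    exact ⟨i, congrArg Prod.fst hi, congrArg Prod.snd hi⟩
  have hsurj : ∀ i, ∃ j, a' j = a i ∧ b' j = b i := fun i =>
    ⟨e.symm ⟨(a i, b i), Finset.mem_image_of_mem _ (Finset.mem_univ i)⟩,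
      by simp only [a', Equiv.apply_symm_apply], by simp only [b', Equiv.apply_symm_apply]⟩
  have hinj : Function.Injective fun j => (a' j, b' j) := by
    intro j j' h
    apply e.injective
    apply Subtype.ext
    exact Prod.ext (congrArg Prod.fst h) (congrArg Prod.snd h)
  have ha'1 : ∀ j, 1 ≤ a' j := fun j => by
    obtain ⟨i, hi, -⟩ := hmem j
    exact hi ▸ ha i
  have hadm' : ∀ p : ℕ, p.Prime → ∃ n : ℕ, ¬p ∣ ∏ j, (a' j * n + b' j) := fun p hp => by
    obtain ⟨n, hn⟩ := hadm p hp
    refine ⟨n, fun hdvd => hn ?_⟩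
    obtain ⟨j, -, hj⟩ := (Nat.Prime.prime hp).exists_mem_finset_dvd hdvd
    obtain ⟨i, hi1, hi2⟩ := hmem j
    rw [← hi1, ← hi2] at hj
    exact hj.trans (Finset.dvd_prod_of_mem (fun i => a i * n + b i) (Finset.mem_univ i))
  obtain ⟨m, hm, hprime⟩ := dickson_injective_of_tupleChebyshev hTC ht1 a' b' ha'1 hinj hadm' M₀
  refine ⟨m, fun i => ?_, hm⟩
  obtain ⟨j, hj1, hj2⟩ := hsurj i
  rw [← hj1, ← hj2]
  exact hprime j

end Chebyshev

/-- The chain `FL ⟹ TupleChebyshev ⟹ Dickson` places `TupleChebyshev` between core and leaf. -/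
theorem chain : (FixedLower → TupleChebyshev) ∧ (TupleChebyshev → DicksonConjecture) :=
  ⟨tupleChebyshev_of_fixedLower, dickson_of_tupleChebyshev⟩

/-- SECOND-LAYER EXACTNESS: `QuantLift ⟺ OrderLift ∧ AsymptoticLift`. -/
theorem quantLift_iff_layers : QuantLift ↔ OrderLift ∧ AsymptoticLift :=
  ⟨fun hq => ⟨fun hD => tupleChebyshev_of_fixedLower (hq hD), fun hT => hq (dickson_of_tupleChebyshev hT)⟩,
    fun h hD => h.2 (h.1 hD)⟩

/-- Three-piece form of the leaf: `FL ⟺ Dickson ∧ OrderLift ∧ AsymptoticLift`. -/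
theorem fixedLower_iff_three : FixedLower ↔ DicksonConjecture ∧ OrderLift ∧ AsymptoticLift := by
  rw [core_iff, quantLift_iff_layers]

/-- `TupleChebyshev` is itself a qualitative-side cut of the leaf: `FL ⟺ TupleChebyshev ∧ AsymptoticLift`. -/
theorem fixedLower_iff_chebyshev : FixedLower ↔ TupleChebyshev ∧ AsymptoticLift :=
  ⟨fun h => ⟨tupleChebyshev_of_fixedLower h, fun _ => h⟩, fun h => h.2 h.1⟩

/-- Every qualitative notch residual also implies the upper factor `AsymptoticLift`. -/
theorem asymptoticLift_of_lift {X : Prop} (hX : DicksonConjecture → X) (hLift : X → FixedLower) :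
    AsymptoticLift :=
  fun hT => hLift (hX (dickson_of_tupleChebyshev hT))

/-- STRICTNESS of the layers (world ¬Dickson): both factors hold there while `FL` fails. -/
theorem layers_of_not_dickson (h : ¬ DicksonConjecture) : OrderLift ∧ AsymptoticLift :=
  quantLift_iff_layers.mp (quantLift_of_not_dickson h)

end Summit.Parity.GeneralizedHardyLittlewood.QualitativeCore
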